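import Summits.CriticalPhenomena.PercolationContinuityZ3.Theorems.SahiMasterFamilyRuleTPrelim

/-!
# RULE T: an explicit removal matching for ONE union-closed family — the `m = 1` case of conjecture (TM), for every `n` and every
# ground set (topped or topless); (TM) holds on the diagonal `𝒱 = 𝒰`

Unit `prim-masterthm-p4` (gen 25; crux anchor stmt-CriticalPhenomena-4575, helper work; memo
`run/shared/lean/prim/prim-masterthm/prim-masterthm-p4/P4-GEN25-REPORT.md` §1).  Third of three files (`…RemovalInjection` →
`…RuleTPrelim` → this); gen 24's `…TransportMatching` §8c asked for exactly this bijection in the one-family case.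

* **`enc_spec` (main lemma, strong induction on `#S`)**: for union-closed `𝒰` and a nonempty `σ`-stable `S` all of whose cycles are
  non-members, the point `enc 𝒰 σ S` of RULE T lies in `S`, after cutting it every cycle inside `S` other than the new fixed point is still
  a non-member, and the decoder rebuilds `σ`: `dec 𝒰 (enc 𝒰 σ S) (cut (enc 𝒰 σ S) σ) S = σ`.  Case (a) is the uncovered-point bijection;
  in case (b) the image's cycle of `M = max S` decides the branch (`y = M` ⇔ `M` was fixed; cycle-with-all-prefixes non-member ⇔ the
  predecessor of `M` was deleted, by the one-step unfolding of `HB`; otherwise the cycle of `M` is untouched and `HB_congr` sends the decoder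
  into the same recursion).
* **`removalMatching_of_unionClosed : (∀ A B ∈ 𝒰, A ∪ B ∈ 𝒰) → RemovalMatching 𝒰`** — THE ONE-FAMILY REMOVAL MATCHING THEOREM, every
  `n`, with or without `univ ∈ 𝒰`; `ruleT_univ` (the explicit rule with its decoder).
* **`transportMatching_diag`**: gen 24's typed conjecture `LabelTransport.TransportMatching` holds for every pair `(𝒰, 𝒰)` with `𝒰`
  union-closed, at every layer (labels ride along: the label transport of `LabelTransport.remove` is an involution determined by `(y, σ)`).
EVIDENCE BEFORE FORMALISATION (memo §1): the rule was machine-checked on all 2 480 union-closed families on ≤ 4 points and on > 2.6·10⁷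
random configurations on 5–9 points; it was FOUND as the 0/1 vertex solution of a product-form flow LP on bad set partitions (memo §2).
HONEST FRAMING: this settles the one-family case of (TM) constructively; it does not touch the two-family interaction — (TM) for pairs,
conjecture (B), `UCHullNonneg k` (k ≥ 8), Sahi's `C_k` and the master theorem remain OPEN (memo §3 localises the pair obstruction at
"crossing complements").  Axioms standard. [this work]
-/

noncomputable section

open scoped Classical

namespace Summit.CriticalPhenomena.PercolationContinuityZ3.Theorems

namespace RemovalInjection

open Finset Function Equiv Equiv.Perm
open Literature.Combinatorics.Sahi2008.CycleForm

variable {n : ℕ}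

/-! ### RULE T is a valid, decodable removal rule on every nonempty union of bad cycles -/

/-- **Main lemma (RULE T works).**  For a union-closed `𝒰` and a nonempty `σ`-stable set `S` all of whose cycles are non-members:
the point `y = enc 𝒰 σ S` lies in `S`, after deleting it every cycle inside `S` other than `{y}` is still a non-member, and the decoder
rebuilds `σ` from `(y, cut y σ)`. [this work] -/
theorem enc_spec {𝒰 : Finset (Finset (Fin (n + 1)))} (hU : ∀ A ∈ 𝒰, ∀ B ∈ 𝒰, A ∪ B ∈ 𝒰) :
    ∀ (k : ℕ) (σ : Perm (Fin (n + 1))) (S : Finset (Fin (n + 1))), S.card = k → S.Nonempty →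
      (∀ x ∈ S, σ x ∈ S) → (∀ i ∈ S, orbit σ i ∉ 𝒰) →
      enc 𝒰 σ S ∈ S ∧
      (∀ i ∈ S, i ≠ enc 𝒰 σ S → orbit (cut (enc 𝒰 σ S) σ) i ∉ 𝒰) ∧
      dec 𝒰 (enc 𝒰 σ S) (cut (enc 𝒰 σ S) σ) S = σ := by
  intro k
  induction k using Nat.strong_induction_on with
  | _ k ih =>
  intro σ S hk hS hstab hbad
  by_cases htop : S ∉ 𝒰
  · ----------------------------------------------------------------- rule (a): topless ground set
    obtain ⟨hpS, hp⟩ := uncovIn_uncov (exists_uncovIn hU hS htop)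
    set p := uncov 𝒰 S with hpdef
    rw [enc_of_not_mem hS htop]
    refine ⟨hstab _ hpS, fun i hi hne => ?_, ?_⟩
    · by_cases h : σ.SameCycle p i
      · intro hmem
        have hpi : p ∈ orbit (cut (σ p) σ) i := mem_orbit.2 (sameCycle_cut_of_sameCycle h hne)
        have hsub : orbit (cut (σ p) σ) i ⊆ S := by
          intro b hb
          exact orbit_subset_of_stable hstab hi (mem_orbit.2 (sameCycle_of_sameCycle_cut (mem_orbit.1 hb)))
        exact hp _ hmem hsub hpi
      · rw [orbit_cut_of_not_sameCycle (fun h' => h h'.symm)]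
        exact hbad i hi
    · rw [dec_of_not_mem hS htop]
      exact swap_mul_cut_succ p σ
  · ----------------------------------------------------------------- rule (b): topped ground set
    have hM : S.max' hS ∈ S := max'_mem S hS
    set M := S.max' hS with hMdef
    by_cases hHB : HB 𝒰 M σ
    · ------------------------------------------------ T1 / T2
      rw [enc_of_HB hS htop hHB]
      have hyS : σ.symm M ∈ S :=
        orbit_subset_of_stable hstab hM (mem_orbit.2 ((sameCycle_symm_apply_right (f := σ)).2 (SameCycle.refl σ M)))
      refine ⟨hyS, ?_, ?_⟩
      · intro i hi hne
        by_cases hfix : σ M = M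
        · -- T1: nothing changes
          have hy : σ.symm M = M := by rw [← hfix, symm_apply_apply, hfix]
          have hcut : cut (σ.symm M) σ = σ := by
            rw [hy, cut, hfix, swap_self]; rfl
          rw [hcut]; exact hbad i hi
        · -- T2
          obtain ⟨hD', -⟩ := (HB_iff_of_apply_ne hfix).1 hHB
          have hyM : σ.SameCycle (σ.symm M) M := sameCycle_symm_apply_left.2 (SameCycle.refl σ M)
          have hMy : M ≠ σ.symm M := fun h => hfix (by simpa using congrArg σ h)
          by_cases h : σ.SameCycle M i
          · have hc : (cut (σ.symm M) σ).SameCycle i M :=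
              sameCycle_cut_of_sameCycle' (hyM.trans h) hyM hne hMy
            rw [orbit_eq_orbit_of_sameCycle hc]; exact hD'
          · have h' : ¬ σ.SameCycle i (σ.symm M) := fun e => h (e.trans hyM).symm
            rw [orbit_cut_of_not_sameCycle' h']; exact hbad i hi
      · by_cases hfix : σ M = M
        · have hy : σ.symm M = M := by rw [← hfix, symm_apply_apply, hfix]
          have hcut : cut (σ.symm M) σ = σ := by
            rw [hy, cut, hfix, swap_self]; rfl
          rw [hcut, dec_of_test hS htop (Or.inl hy), hy, swap_self]; rfl
        · have ht := (HB_iff_of_apply_ne (𝒰 := 𝒰) hfix).1 hHB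
          rw [dec_of_test hS htop (Or.inr ht), cut, apply_symm_apply, ← mul_assoc, swap_mul_self, one_mul]
    · ------------------------------------------------ T3: recurse on the complement of the cycle of `M`
      have hfix : σ M ≠ M := fun h => hHB (HB_of_apply_eq h)
      rw [enc_of_not_HB hS htop hHB]
      set S' := S \ orbit σ M with hS'def
      have hlt : S'.card < k := hk ▸ card_sdiff_lt_of_mem hM (self_mem_orbit σ M)
      have hDS : orbit σ M ⊆ S := orbit_subset_of_stable hstab hM
      have hS'ne : S'.Nonempty := by
        rw [nonempty_iff_ne_empty]
        intro he
        have hSD : S = orbit σ M := by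
          refine Subset.antisymm (fun x hx => ?_) hDS
          by_contra hxD
          have : x ∈ S' := mem_sdiff.2 ⟨hx, hxD⟩
          rw [he] at this; exact absurd this (by simp)
        exact hbad M hM (hSD ▸ not_not.1 htop)
      have hstab' : ∀ x ∈ S', σ x ∈ S' := by
        intro x hx
        rw [mem_sdiff] at hx ⊢
        refine ⟨hstab x hx.1, fun hσx => hx.2 ?_⟩
        exact mem_orbit.2 (sameCycle_apply_right.1 (mem_orbit.1 hσx))
      have hbad' : ∀ i ∈ S', orbit σ i ∉ 𝒰 := fun i hi => hbad i (mem_sdiff.1 hi).1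
      obtain ⟨hy, hval, hdec⟩ := ih _ hlt σ S' rfl hS'ne hstab' hbad'
      set y := enc 𝒰 σ S' with hydef
      have hyS : y ∈ S := (mem_sdiff.1 hy).1
      have hyD : y ∉ orbit σ M := (mem_sdiff.1 hy).2
      -- the short-cut agrees with `σ` on the cycle of `M`
      have hnsc : ∀ x ∈ orbit σ M, ¬ σ.SameCycle x y := by
        intro x hx hxy
        exact hyD (by rw [orbit_eq_orbit_of_sameCycle (mem_orbit.1 hx)]; exact mem_orbit.2 hxy)
      have hagree : ∀ x ∈ orbit σ M, cut y σ x = σ x := fun x hx => cut_apply_of_not_sameCycle (hnsc x hx)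
      refine ⟨hyS, ?_, ?_⟩
      · intro i hi hne
        by_cases hiS' : i ∈ S'
        · exact hval i hiS' hne
        · have hiD : i ∈ orbit σ M := by
            by_contra h; exact hiS' (mem_sdiff.2 ⟨hi, h⟩)
          rw [orbit_cut_of_not_sameCycle' (hnsc i hiD)]
          exact hbad i hi
      · have hyM : y ≠ M := fun h => hyD (h ▸ self_mem_orbit σ M)
        have hHB' : ¬ HB 𝒰 M (cut y σ) := by
          rw [HB_congr (orbit σ M).card rfl hagree]; exact hHB
        have hnt : ¬ (y = M ∨ (orbit (cut y σ) M ∉ 𝒰 ∧ HB 𝒰 M (cut y σ))) := by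
          rintro (h | ⟨-, h⟩)
          · exact hyM h
          · exact hHB' h
        rw [dec_of_not_test hS htop hnt, orbit_eq_of_agree hagree]
        exact hdec

/-! ### The theorem: every union-closed family admits an explicit removal matching -/

/-- **ONE-FAMILY REMOVAL MATCHING THEOREM (RULE T).**  For every union-closed family `𝒰` of subsets of `Fin (n+1)` — containing `univ`
or not — the assignment `σ ↦ enc 𝒰 σ univ` (RULE T: on a topless ground set delete the successor of an uncovered point; on a topped one
delete the predecessor of the maximum when its cycle is hereditarily bad, else recurse on the complement of that cycle) deletes from every
`𝒰`-avoiding permutation a point whose removal keeps it avoiding, injectively.  This is the `m = 1` case of conjecture (TM) (gen 24),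
constructively, for every `n`. [this work] -/
theorem removalMatching_of_unionClosed {𝒰 : Finset (Finset (Fin (n + 1)))} (hU : ∀ A ∈ 𝒰, ∀ B ∈ 𝒰, A ∪ B ∈ 𝒰) :
    RemovalMatching 𝒰 := by
  refine ⟨fun σ => enc 𝒰 σ univ, fun σ hσ => ?_, fun σ₁ σ₂ h₁ h₂ hf hc => ?_⟩
  · obtain ⟨-, hval, -⟩ := enc_spec hU _ σ univ rfl univ_nonempty (fun _ _ => mem_univ _) (fun i _ => hσ i)
    exact ⟨cut_apply_self _ _, fun i hi => hval i (mem_univ i) hi⟩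
  · obtain ⟨-, -, hd₁⟩ := enc_spec hU _ σ₁ univ rfl univ_nonempty (fun _ _ => mem_univ _) (fun i _ => h₁ i)
    obtain ⟨-, -, hd₂⟩ := enc_spec hU _ σ₂ univ rfl univ_nonempty (fun _ _ => mem_univ _) (fun i _ => h₂ i)
    simp only at hf hc
    rw [← hd₁, hc, hf, hd₂]

/-- The same packaged as an explicit rule with its three properties (validity, injectivity via the decoder). [this work] -/
theorem ruleT_univ {𝒰 : Finset (Finset (Fin (n + 1)))} (hU : ∀ A ∈ 𝒰, ∀ B ∈ 𝒰, A ∪ B ∈ 𝒰) {σ : Perm (Fin (n + 1))}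
    (hσ : Avoids 𝒰 σ) :
    AvoidsOff 𝒰 (enc 𝒰 σ univ) (cut (enc 𝒰 σ univ) σ) ∧ dec 𝒰 (enc 𝒰 σ univ) (cut (enc 𝒰 σ univ) σ) univ = σ := by
  obtain ⟨-, hval, hdec⟩ := enc_spec hU _ σ univ rfl univ_nonempty (fun _ _ => mem_univ _) (fun i _ => hσ i)
  exact ⟨⟨cut_apply_self _ _, fun i hi => hval i (mem_univ i) hi⟩, hdec⟩

/-! ### Corollary: conjecture (TM) of `…TransportMatching` holds on the diagonal `𝒱 = 𝒰` -/

/-- With equal families the label of a cycle is irrelevant: `LabelTransport.AllBad 𝒰 𝒰 c ↔ Avoids 𝒰 c.1`. [this work] -/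
theorem allBad_diag_iff {𝒰 : Finset (Finset (Fin (n + 1)))} (c : LabelTransport.Config n) :
    LabelTransport.AllBad 𝒰 𝒰 c ↔ Avoids 𝒰 c.1 := by
  unfold LabelTransport.AllBad LabelTransport.badSet LabelTransport.famOf Avoids
  simp only [ite_self]

/-- Likewise for the pointed version. [this work] -/
theorem allBadOff_diag_iff {𝒰 : Finset (Finset (Fin (n + 1)))} (y : Fin (n + 1)) (c : LabelTransport.Config n) :
    LabelTransport.AllBadOff 𝒰 𝒰 y c ↔ AvoidsOff 𝒰 y c.1 := by
  unfold LabelTransport.AllBadOff LabelTransport.badSet LabelTransport.famOf AvoidsOff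
  simp only [ite_self]

/-- The permutation part of gen 24's removal-with-transport is the short-cut. [this work] -/
theorem remove_fst (y : Fin (n + 1)) (c : LabelTransport.Config n) : (LabelTransport.remove y c).1 = cut y c.1 := rfl

/-- **(TM) on the diagonal.**  For a union-closed `𝒰` the typed conjecture `LabelTransport.TransportMatching` holds for the pair `(𝒰, 𝒰)`
(labels ride along; gen 24's label transport is a bijection on labellings determined by `(y, σ)`), at every layer — by RULE T.  The
hypothesis `univ ∈ 𝒰` of (TM) is not even needed. [this work] -/
theorem transportMatching_diag {𝒰 : Finset (Finset (Fin (n + 1)))} (hU : ∀ A ∈ 𝒰, ∀ B ∈ 𝒰, A ∪ B ∈ 𝒰) (s : ℕ) :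
    ∃ f : LabelTransport.Config n → Fin (n + 1),
      (∀ c, LabelTransport.AllBad 𝒰 𝒰 c → LabelTransport.layer c = s →
        LabelTransport.AllBadOff 𝒰 𝒰 (f c) (LabelTransport.remove (f c) c)) ∧
      (∀ c₁ c₂, LabelTransport.AllBad 𝒰 𝒰 c₁ → LabelTransport.AllBad 𝒰 𝒰 c₂ → LabelTransport.layer c₁ = s →
        LabelTransport.layer c₂ = s → f c₁ = f c₂ → LabelTransport.remove (f c₁) c₁ = LabelTransport.remove (f c₂) c₂ → c₁ = c₂) := by
  refine ⟨fun c => enc 𝒰 c.1 univ, fun c hc _ => ?_, fun c₁ c₂ h₁ h₂ _ _ hf hr => ?_⟩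
  · rw [allBadOff_diag_iff, remove_fst]
    exact (ruleT_univ hU ((allBad_diag_iff c).1 hc)).1
  · have hσ : c₁.1 = c₂.1 := by
      have e1 := (ruleT_univ hU ((allBad_diag_iff c₁).1 h₁)).2
      have e2 := (ruleT_univ hU ((allBad_diag_iff c₂).1 h₂)).2
      have hcut : cut (enc 𝒰 c₁.1 univ) c₁.1 = cut (enc 𝒰 c₂.1 univ) c₂.1 := by
        rw [← remove_fst, ← remove_fst, hr]
      simp only at hf
      rw [← e1, hcut, hf, e2]
    -- labels: the transport is the same involution on both sides
    have hlab : c₁.2 = c₂.2 := by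
      have h2 := congrArg Prod.snd hr
      simp only at hf
      unfold LabelTransport.remove at h2
      simp only [hσ] at h2
      split_ifs at h2 with hcase
      · funext i
        have := congrFun h2 (Equiv.swap (enc 𝒰 c₂.1 univ) (((orbit c₂.1 (enc 𝒰 c₂.1 univ)).erase (enc 𝒰 c₂.1 univ)).min' hcase.1) i)
        simpa [Function.comp, Equiv.swap_apply_self] using this
      · exact h2
    exact Prod.ext hσ hlab


end RemovalInjection

end Summit.CriticalPhenomena.PercolationContinuityZ3.Theorems
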